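import Summits.AtomisticToContinuum.HydrodynamicLimit.Theses.InformationPercolationEngine
import Summits.AtomisticToContinuum.HydrodynamicLimit.Theorems.InformationPercolationEngineChaosClosesEulerEnskogTensor
import HarnessLib

/-!
# Moments of the local Maxwellian measure

Helper for the line `Sketch` of the crux `InformationPercolationEngine.ChaosClosesEuler`
(stmt-AtomisticToContinuum-15141), skeleton v11 (`Cruxes/ChaosClosesEuler/Lines/Sketch.lean`), registered stub
`stub_maxwellianMoments`: for `ρ, θ > 0`, `u ∈ ℝ³` the measure with density `localMaxwellian ρ θ u` is finite with `|v|²` integrable, mass `ρ`, momentum `ρu`, second moments `ρ(uⱼuₖ + θδⱼₖ)`, energy `ρ(|u|² + 3θ)`, and integrates a bounded continuous `ψ` to `ρ ∫ ψ M_{1,θ,u}`.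

Proof: `M_{ρ,θ,u} = ρ M_{1,θ,u}` and `M_{1,θ,u} dv = gaussMeasure u θ`
(`withDensity_localMaxwellian_eq_gaussMeasure`, the isotropic Gaussian `N(u, θ id)`, Mathlib's
`multivariateGaussian u (θ • 1)`), so the measure is `ρ • N(u, θ id)`; the moments are the mean
(`integral_coord_gaussMeasure`), the covariance matrix (`covariance_eval_multivariateGaussian`) and the
mean kinetic energy (`integral_energy_gaussMeasure`) of that Gaussian.

References: C. Cercignani, R. Illner, M. Pulvirenti, *The Mathematical Theory of Dilute Gases* (1994), §3.2.
-/

noncomputable section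

namespace Summit.AtomisticToContinuum.HydrodynamicLimit.Theorems.ChaosClosesEulerMaxwellianMoments

open scoped BigOperators Topology Classical MeasureTheory ENNReal InnerProductSpace
open Filter Set MeasureTheory ProbabilityTheory
open Literature.MathematicalPhysics.KineticTheory
open Literature.Analysis.FluidPDE
open Summit.AtomisticToContinuum.HydrodynamicLimit.Theses
open Summit.AtomisticToContinuum.HydrodynamicLimit.Theses.InformationPercolationEngine

/-- `M_{ρ,θ,u} = ρ M_{1,θ,u}`. [folklore] -/
theorem localMaxwellian_eq_mul_one (ρ θ : ℝ) (u v : V3) :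
    localMaxwellian ρ θ u v = ρ * localMaxwellian 1 θ u v := by
  simp only [localMaxwellian, one_mul]
  ring

/-- **The local Maxwellian measure is `ρ • N(u, θ id)`**: for `ρ ≥ 0`, `θ > 0`,
`M_{ρ,θ,u}(v) dv = ρ • gaussMeasure u θ`. [folklore] -/
theorem withDensity_localMaxwellian_eq_smul_gaussMeasure {ρ θ : ℝ} (hρ : 0 ≤ ρ) (hθ : 0 < θ)
    (u : V3) :
    (volume : Measure V3).withDensity (fun v => ENNReal.ofReal (localMaxwellian ρ θ u v)) =
      ENNReal.ofReal ρ • gaussMeasure u θ := by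
  have h : (fun v => ENNReal.ofReal (localMaxwellian ρ θ u v)) =
      ENNReal.ofReal ρ • fun v => ENNReal.ofReal (localMaxwellian 1 θ u v) := by
    funext v
    rw [Pi.smul_apply, smul_eq_mul, ← ENNReal.ofReal_mul hρ, localMaxwellian_eq_mul_one]
  rw [h, withDensity_smul _ (continuous_localMaxwellian 1 θ u).measurable.ennreal_ofReal,
    withDensity_localMaxwellian_eq_gaussMeasure hθ u]

/-- Pairing with `M_{1,θ,u}` is integration against `gaussMeasure u θ`:
`∫ ψ dN(u, θ id) = ∫ ψ M_{1,θ,u} dv` (`θ > 0`). [folklore] -/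
theorem integral_gaussMeasure_eq_integral_mul_localMaxwellian {θ : ℝ} (hθ : 0 < θ) (u : V3)
    (ψ : V3 → ℝ) :
    ∫ v, ψ v ∂gaussMeasure u θ = ∫ v, ψ v * localMaxwellian 1 θ u v := by
  rw [← withDensity_localMaxwellian_eq_gaussMeasure hθ u,
    integral_withDensity_eq_integral_toReal_smul₀
      (continuous_localMaxwellian 1 θ u).measurable.ennreal_ofReal.aemeasurable
      (Eventually.of_forall fun _ => ENNReal.ofReal_lt_top)]
  refine integral_congr_ae (Eventually.of_forall fun v => ?_)
  simp only [smul_eq_mul]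
  rw [ENNReal.toReal_ofReal (localMaxwellian_nonneg zero_le_one hθ.le u v), mul_comm]

/-- Second moments of the isotropic Gaussian: `∫ v_j v_k dN(u, θ id) = u_j u_k + θ δ_jk` (`θ > 0`;
covariance matrix `θ • 1`, mean `u`). [folklore] -/
theorem integral_coord_mul_coord_gaussMeasure {θ : ℝ} (hθ : 0 < θ) (u : V3) (j k : Fin 3) :
    ∫ v, v j * v k ∂gaussMeasure u θ = u j * u k + if j = k then θ else 0 := by
  have hS : (θ • (1 : Matrix (Fin 3) (Fin 3) ℝ)).PosSemidef := Matrix.PosSemidef.one.smul hθ.le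
  have hcov := covariance_eval_multivariateGaussian (μ := u) hS j k
  rw [← gaussMeasure_eq_multivariateGaussian u hθ.le,
    covariance_eq_sub (memLp_coord_gaussMeasure u θ j 2 (by simp))
      (memLp_coord_gaussMeasure u θ k 2 (by simp)),
    integral_coord_gaussMeasure u hθ j, integral_coord_gaussMeasure u hθ k] at hcov
  simp only [Pi.mul_apply, Matrix.smul_apply, Matrix.one_apply, smul_eq_mul, mul_ite, mul_one,
    mul_zero] at hcov
  rw [sub_eq_iff_eq_add'] at hcov
  exact hcov

/-- Mean square speed of the isotropic Gaussian: `∫ |v|² dN(u, θ id) = |u|² + 3θ` (`θ > 0`). [folklore] -/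
theorem integral_norm_sq_gaussMeasure {θ : ℝ} (hθ : 0 < θ) (u : V3) :
    ∫ v, ‖v‖ ^ 2 ∂gaussMeasure u θ = ‖u‖ ^ 2 + 3 * θ := by
  have hsq : Integrable (fun v : V3 => ‖v‖ ^ 2) (gaussMeasure u θ) :=
    (IsGaussian.memLp_id _ 2 (by simp)).integrable_norm_pow (by norm_num)
  have h0 := integral_energy_gaussMeasure u hθ
  have h1 : ∫ v, (‖v‖ ^ 2 / 2 - ‖u‖ ^ 2 / 2 - (Fintype.card (Fin 3)) * θ / 2) ∂gaussMeasure u θ =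
      (∫ v, ‖v‖ ^ 2 ∂gaussMeasure u θ) / 2 - ‖u‖ ^ 2 / 2 - 3 * θ / 2 := by
    rw [integral_sub, integral_sub, integral_const, integral_const, integral_div]
    · simp
    · exact hsq.div_const 2
    · exact integrable_const _
    · exact (hsq.div_const 2).sub (integrable_const _)
    · exact integrable_const _
  rw [h1] at h0
  linarith

/-- Registered stub `stub_maxwellianMoments` of skeleton v11 (line `Sketch`, crux stmt-AtomisticToContinuum-15141): for `ρ, θ > 0`, `u ∈ ℝ³` the measure with density `localMaxwellian ρ θ u` is finite with `|v|²` integrable, mass `ρ`, momentum `ρu`, second moments `ρ(uⱼuₖ + θδⱼₖ)`, energy `ρ(|u|² + 3θ)`, and integrates a bounded continuous `ψ` to `ρ ∫ ψ M_{1,θ,u}`. [folklore] -/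
theorem stub_maxwellianMoments :
    ∀ (ρ θ : ℝ) (u : V3), 0 < ρ → 0 < θ →
      let m : Measure V3 := volume.withDensity (fun v => ENNReal.ofReal (localMaxwellian ρ θ u v))
      IsFiniteMeasure m ∧ Integrable (fun v : V3 => ‖v‖ ^ 2) m ∧
      (m Set.univ).toReal = ρ ∧ (∀ j : Fin 3, ∫ v, v j ∂m = ρ * u j) ∧
      (∀ j k : Fin 3, ∫ v, v j * v k ∂m = ρ * (u j * u k + if j = k then θ else 0)) ∧
      (∫ v, ‖v‖ ^ 2 ∂m = ρ * (‖u‖ ^ 2 + 3 * θ)) ∧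
      (∀ ψ : V3 → ℝ, Continuous ψ → (∃ C : ℝ, ∀ v, |ψ v| ≤ C) →
        Integrable ψ m ∧ ∫ v, ψ v ∂m = ρ * ∫ v, ψ v * localMaxwellian 1 θ u v) := by
  intro ρ θ u hρ hθ m
  have hm : m = ENNReal.ofReal ρ • gaussMeasure u θ :=
    withDensity_localMaxwellian_eq_smul_gaussMeasure hρ.le hθ u
  have hcr : (ENNReal.ofReal ρ).toReal = ρ := ENNReal.toReal_ofReal hρ.le
  have hsq : Integrable (fun v : V3 => ‖v‖ ^ 2) (gaussMeasure u θ) :=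
    (IsGaussian.memLp_id _ 2 (by simp)).integrable_norm_pow (by norm_num)
  rw [hm]
  refine ⟨⟨?_⟩, hsq.smul_measure ENNReal.ofReal_ne_top, ?_, fun j => ?_, fun j k => ?_, ?_,
    fun ψ hψ hC => ?_⟩
  · rw [Measure.smul_apply, smul_eq_mul, measure_univ, mul_one]
    exact ENNReal.ofReal_lt_top
  · rw [Measure.smul_apply, smul_eq_mul, measure_univ, mul_one, hcr]
  · rw [integral_smul_measure, hcr, smul_eq_mul, integral_coord_gaussMeasure u hθ j]
  · rw [integral_smul_measure, hcr, smul_eq_mul, integral_coord_mul_coord_gaussMeasure hθ u j k]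
  · rw [integral_smul_measure, hcr, smul_eq_mul, integral_norm_sq_gaussMeasure hθ u]
  · obtain ⟨C, hC⟩ := hC
    have hint : Integrable ψ (gaussMeasure u θ) := by
      refine (integrable_const C).mono' hψ.aestronglyMeasurable (Eventually.of_forall fun v => ?_)
      rw [Real.norm_eq_abs]
      exact hC v
    refine ⟨hint.smul_measure ENNReal.ofReal_ne_top, ?_⟩
    rw [integral_smul_measure, hcr, smul_eq_mul,
      integral_gaussMeasure_eq_integral_mul_localMaxwellian hθ u ψ]

end Summit.AtomisticToContinuum.HydrodynamicLimit.Theorems.ChaosClosesEulerMaxwellianMoments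

end
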